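import Summits.QuantumFields.BalabanUV.Beta.ValueHessianGauge
import Summits.QuantumFields.BalabanUV.Beta.GAN24.PiBmConstants
import Summits.QuantumFields.BalabanUV.Beta.GAN24.PeriodicKKTExchangePairing

/-!
# `BalabanUV.Beta.GAN24.ValueHessianLinearGauge` — binder row G-an2-4 ∕ (CONV-C), W-slot (α-0), ROW (C) AT LEVELS `j ≥ 1`, data letter D1 of the (γ) hand's memo
# `HOME/b2b-balaban-gan24-formalise-leaf-06/g52/C-LEVELS-GE1.md` §17: **THE VALUE HESSIAN KILLS PURE GAUGES OF LINEAR GROWTH — hence CONSTANT 1-forms and the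
# EXIT-FACE PROFILE** — `Σ'_y Σ_l E2 d Lc j (x,y)_{κl}·(φ(y + e_l) − φ y) = 0` for every potential with `|φ y| ≤ A + B·|y|₁` (every `j`, every `d`, `Lc ≥ 1`); instances:
# `Σ'_y Σ_l E2_j(x,y)_{κl}·c_l = 0` (constants: `φ` linear) and `Σ'_y E2_j(x,y)_{κβ}·[y_β % N = N−1]·g = 0` (the exit-face profile of the `N`-blocks: `φ = g·⌊y_β∕N⌋`);
# and the block contour sums of «sawtooth × exit-face profile» vanish across directions
# (G-an2-4 CRUX TEAM (2), seat `b2b-balaban-gan24-formalise-leaf-06` = the (γ) hand, gen 52; journal INTENT I-leaf06-g52-3)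

NOT IN PRINT; OUR BOOKKEEPING ([folklore] summation by parts BY NAME: an2's co-closedness `BorderedHessian.codiff₁_wΦ_right` ∕ `codiff₁_wΦ_shift` (`ValueHessianBlind`), the
decay `KernelSpecInstance.decay_wΦ`, the entry dictionary `E2_inl_inl_eq_wΦ`, the shift `ValueHessianGauge.tsum_mul_comp_add_shift`, `PiBmConstants.int_succ_ediv`; the finite-support
versions are d1-leaf-06's `ValueHessianGauge.tsum_wΦ_mul_grad_eq_zero` ∕ `tsum_E2_mul_grad_eq_zero` — this file only widens the class of potentials; 0 `def`, 0 cited fact, 0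
`def … : Prop`, 0 sorry).
HONEST FRAMING (cell contract, verbatim): «discharging `BetaPertH` makes Bałaban's UV stability UNCONDITIONAL — a real constructive-QFT result; it is NOT the continuum
limit and NOT the Clay problem.»  HONEST DEPENDENCY (verbatim): «continuum YM on T⁴ ⇐ BetaPertH ∧ nine spine estimates (0/9 proved); BetaPertH ⇐ (D1) ∧ (D4) ∧ CAP+tail;
G-an2-4 gates asym, D1 and NE2/3/4.»

WHY (row (C) at levels `j ≥ 1`, EX side, memo §17 (W3)∕(W6)).  In leaf-04's two-face currency the legs of every word of `zmode Lc b̃_j` carry the EXIT-FACE profile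
`𝟙f_β(y) = [y_β % Lc = Lc − 1]` (`DressedStepFaceCharges`), and the dressed background is `Π_bm c̃_ν = Lc·𝟙f_ν = c̃_ν − d(y ↦ y_ν % Lc)` (`PiBmConstants.axProjBmAt_const`).  After
the cubic background letter L1 the direct exchange word's right current is `E2_j (λ_ν ⊙ 𝟙f_β) − λ_ν ⊙ (E2_j 𝟙f_β)`; the second term DIES because the exit-face profile is a pure
gauge of LINEAR growth (`𝟙f_β = d ⌊·_β∕Lc⌋` on `β`-bonds) — §3; the constant legs `ĉ` of the (S2c)-type readings are `d` of a linear potential — §3; and on the diagonal `ν = β` the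
datum `λ_β ⊙ 𝟙f_β` is `λ_β(Lc−1)·𝟙f_β`, again a face profile.  §4 records the companion fact for L4′ (`StepCovarianceSandwichApply`): across directions (`ν ≠ β`) the `Lc`-block
contour sums of «zero-mean `Lc`-periodic function of `y_ν` × exit-face profile on `β`-bonds» VANISH, so the tent term of the sandwich drops on these data.
* §1 `summable_wΦ_shift_mul_of_linGrowth` — `y ↦ wΦ κ l (x − y + v)·φ y` is summable for `|φ y| ≤ A + B·|y|₁` (exponential decay beats linear growth: `t ≤ (2∕δ)·e^{δt∕2}`).
* §2 **`tsum_wΦ_mul_grad_eq_zero_of_summable`** (column form; hypothesis: the three shifted products summable) and **`tsum_wΦ_mul_grad_eq_zero_of_linGrowth`**; row twins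
  `tsum_grad_mul_wΦ_eq_zero_of_summable` ∕ `_of_linGrowth`.
* §3 `E2` versions: **`tsum_E2_mul_grad_eq_zero_of_linGrowth`**, **`tsum_grad_mul_E2_eq_zero_of_linGrowth`**; instances **`tsum_E2_mul_const_eq_zero`** ∕ `tsum_const_mul_E2_eq_zero`
  (constant 1-forms), **`tsum_E2_mul_exitFace_eq_zero`** ∕ `tsum_exitFace_mul_E2_eq_zero` (exit-face profile of the `N`-blocks, any `N ≥ 1`, weight `g`).
* §4 **`contourSum_periodic_mul_exitFace_eq_zero`** — `contourSum Lc (l,y ↦ [l = β]·ψ(y_ν)·[y_β % Lc = Lc−1]) = 0` for `ν ≠ β`, `ψ` `Lc`-periodic with `Σ_{t<Lc} ψ t = 0`.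
Asserts NO value of Bałaban's tables; discharges NOTHING of (C) ∕ (C)sym ∕ (Q-L) ∕ «T2Shape» ∕ «T2Drift» ∕ (hW, hWall); NEVER «G-an2-4 closed» as (CONV-C); NOT D1, NOT
`BetaPertH`, NOT continuum, NOT Clay.  2026-08-23; no existing file touched.
-/

noncomputable section

namespace Summit.QuantumFields.BalabanUV.Beta.GAN24.ValueHessianLinearGauge

open Finset
open scoped BigOperators
open Literature.MathematicalPhysics.QuantumFieldTheory
open Literature.MathematicalPhysics.QuantumFieldTheory.Balaban1983to89
open Literature.MathematicalPhysics.QuantumFieldTheory.Balaban1983to89.Beta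
open B12Sec2to5 (l1 l1_nonneg abs_coord_le_l1)
open ExpKernelCalculus (Site MKer summable_exp_shift l1_sub_triangle l1_sub_symm)
open AffineAveraging (Form1 unitVec codiff₁ box toSite contourSum)
open KernelSpecInstance (wΦ decay_wΦ)
open OneStepResolventKernel (Fib)
open BalabanStepJetsSucc (E2)
open Summit.QuantumFields.BalabanUV.Beta.BorderedHessian (E2_inl_inl_eq_wΦ codiff₁_wΦ_right codiff₁_wΦ_shift)
open Summit.QuantumFields.BalabanUV.Beta.ValueHessianGauge (tsum_mul_comp_add_shift)
open Summit.QuantumFields.BalabanUV.Beta.GAN24.PiBmConstants (int_succ_ediv)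
open Summit.QuantumFields.BalabanUV.Beta.GAN24.PeriodicKKTExchangePairing (sum_box_mul_coord)

variable {d : ℕ}

/-! ## §1 Exponential decay beats linear growth -/

/-- [folklore] `t ≤ (2∕δ)·e^{(δ∕2)·t}` for `t ≥ 0`, `δ > 0`. -/
theorem le_two_div_mul_exp {δ t : ℝ} (hδ : 0 < δ) (_ht : 0 ≤ t) : t ≤ (2 / δ) * Real.exp ((δ / 2) * t) := by
  have h := Real.add_one_le_exp ((δ / 2) * t)
  have h2 : (δ / 2) * t ≤ Real.exp ((δ / 2) * t) := by linarith
  have hδ2 : 0 < δ / 2 := by positivity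
  calc t = (2 / δ) * ((δ / 2) * t) := by field_simp
    _ ≤ (2 / δ) * Real.exp ((δ / 2) * t) := mul_le_mul_of_nonneg_left h2 (by positivity)

section WΦ

variable {N : ℕ} [NeZero N]

/-- [folklore] **EXPONENTIAL DECAY ABOUT A CENTRE BEATS LINEAR GROWTH**: `|K z| ≤ C·e^{−δ|c−z|₁}` and `|φ z| ≤ A + B·|z|₁` ⟹ `z ↦ K z·φ z` summable
(majorant `C(|A| + |B||c|₁)e^{−δ|c−z|₁} + C|B|(2∕δ)e^{−(δ∕2)|c−z|₁}`, using `t ≤ (2∕δ)e^{δt∕2}`). -/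
theorem summable_decay_mul_of_linGrowth {K φ : Site (d + 1) → ℝ} {C δ A B : ℝ} (hδ : 0 < δ) (c : Site (d + 1))
    (hK : ∀ z, |K z| ≤ C * Real.exp (-δ * l1 (c - z))) (hφ : ∀ z, |φ z| ≤ A + B * l1 z) : Summable fun z => K z * φ z := by
  have hC : 0 ≤ C := by
    have h := hK c
    have hexp : 0 < Real.exp (-δ * l1 (c - c)) := Real.exp_pos _
    nlinarith [abs_nonneg (K c)]
  have hB' : (0 : ℝ) ≤ |B| := abs_nonneg B
  have hmaj : Summable fun z : Site (d + 1) =>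
      C * (|A| + |B| * l1 c) * Real.exp (-δ * l1 (c - z)) + C * |B| * (2 / δ) * Real.exp (-(δ / 2) * l1 (c - z)) :=
    (((summable_exp_shift hδ c).mul_left _).add ((summable_exp_shift (half_pos hδ) c).mul_left _))
  refine Summable.of_norm_bounded hmaj fun z => ?_
  rw [Real.norm_eq_abs, abs_mul]
  have hl : l1 z ≤ l1 c + l1 (c - z) := by
    have h := l1_sub_triangle z c 0
    simp only [sub_zero] at h
    rw [l1_sub_symm z c] at h
    linarith
  have hgrow : |φ z| ≤ (|A| + |B| * l1 c) + |B| * l1 (c - z) := by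
    calc |φ z| ≤ |A| + |B| * l1 z := (hφ z).trans (add_le_add (le_abs_self A) (mul_le_mul_of_nonneg_right (le_abs_self B) (l1_nonneg z)))
      _ ≤ |A| + |B| * (l1 c + l1 (c - z)) := by gcongr
      _ = _ := by ring
  have hexp2 : l1 (c - z) * Real.exp (-δ * l1 (c - z)) ≤ (2 / δ) * Real.exp (-(δ / 2) * l1 (c - z)) := by
    have h := le_two_div_mul_exp hδ (l1_nonneg (c - z))
    calc l1 (c - z) * Real.exp (-δ * l1 (c - z)) ≤ ((2 / δ) * Real.exp ((δ / 2) * l1 (c - z))) * Real.exp (-δ * l1 (c - z)) :=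
          mul_le_mul_of_nonneg_right h (Real.exp_pos _).le
      _ = (2 / δ) * Real.exp (-(δ / 2) * l1 (c - z)) := by
          rw [mul_assoc, ← Real.exp_add]; congr 2; ring
  have hA0 : 0 ≤ |A| + |B| * l1 c := add_nonneg (abs_nonneg A) (mul_nonneg hB' (l1_nonneg c))
  calc |K z| * |φ z|
      ≤ (C * Real.exp (-δ * l1 (c - z))) * ((|A| + |B| * l1 c) + |B| * l1 (c - z)) := mul_le_mul (hK z) hgrow (abs_nonneg _) (by positivity)
    _ = C * (|A| + |B| * l1 c) * Real.exp (-δ * l1 (c - z)) + C * |B| * (l1 (c - z) * Real.exp (-δ * l1 (c - z))) := by ring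
    _ ≤ C * (|A| + |B| * l1 c) * Real.exp (-δ * l1 (c - z)) + C * |B| * ((2 / δ) * Real.exp (-(δ / 2) * l1 (c - z))) := by gcongr
    _ = _ := by ring

/-- [folklore] **THE SHIFTED KERNEL TIMES A POTENTIAL OF LINEAR GROWTH IS SUMMABLE** (column form): `y ↦ wΦ κ l (x − y + v)·φ y`. -/
theorem summable_wΦ_shift_mul_of_linGrowth {φ : Site (d + 1) → ℝ} {A B : ℝ} (hφ : ∀ y, |φ y| ≤ A + B * l1 y) (κ l : Fin (d + 1))
    (x v : Site (d + 1)) : Summable fun y => wΦ (N := N) κ l (x - y + v) * φ y := by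
  obtain ⟨δ, C, hδ, hdec⟩ := decay_wΦ (N := N) (d := d)
  refine summable_decay_mul_of_linGrowth (C := C) hδ (x + v) (fun y => ?_) hφ
  have e : x - y + v = x + v - y := by abel
  rw [e]
  exact hdec κ l (x + v - y)

/-- [folklore] … (row form): `x ↦ wΦ κ l (x − w − y)·φ x`. -/
theorem summable_wΦ_row_mul_of_linGrowth {φ : Site (d + 1) → ℝ} {A B : ℝ} (hφ : ∀ y, |φ y| ≤ A + B * l1 y) (κ l : Fin (d + 1))
    (y w : Site (d + 1)) : Summable fun x => wΦ (N := N) κ l (x - w - y) * φ x := by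
  obtain ⟨δ, C, hδ, hdec⟩ := decay_wΦ (N := N) (d := d)
  refine summable_decay_mul_of_linGrowth (C := C) hδ (w + y) (fun x => ?_) hφ
  have e : x - w - y = x - (w + y) := by abel
  rw [e, l1_sub_symm (w + y) x]
  exact hdec κ l (x - (w + y))

set_option maxHeartbeats 400000 in
/-- [folklore] **`wΦ` KILLS PURE GAUGES (column form, summable class)**: if the three products `y ↦ wΦ κ l (x − y)·φ(y + e_l)`, `y ↦ wΦ κ l (x − y)·φ y`,
`y ↦ wΦ κ l (x − y + e_l)·φ y` are summable for every `l`, then `Σ'_y Σ_l wΦ κ l (x − y)·(φ (y + e_l) − φ y) = 0` (d1-leaf-06's summation by parts, hypotheses widened). -/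
theorem tsum_wΦ_mul_grad_eq_zero_of_summable (κ : Fin (d + 1)) (x : Site (d + 1)) {φ : Site (d + 1) → ℝ}
    (hf : ∀ l : Fin (d + 1), Summable fun y => wΦ (N := N) κ l (x - y) * φ (y + unitVec l))
    (hg : ∀ l : Fin (d + 1), Summable fun y => wΦ (N := N) κ l (x - y) * φ y)
    (hs : ∀ l : Fin (d + 1), Summable fun y => wΦ (N := N) κ l (x - y + unitVec l) * φ y) :
    ∑' y, ∑ l, wΦ (N := N) κ l (x - y) * (φ (y + unitVec l) - φ y) = 0 := by
  have hfg : ∀ l : Fin (d + 1), Summable fun y => wΦ (N := N) κ l (x - y) * (φ (y + unitVec l) - φ y) := fun l =>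
    ((hf l).sub (hg l)).congr fun y => by ring
  calc ∑' y, ∑ l, wΦ (N := N) κ l (x - y) * (φ (y + unitVec l) - φ y)
      = ∑ l, ∑' y, wΦ (N := N) κ l (x - y) * (φ (y + unitVec l) - φ y) :=
        Summable.tsum_finsetSum fun l _ => hfg l
    _ = ∑ l, ((∑' y, wΦ (N := N) κ l (x - y + unitVec l) * φ y) - ∑' y, wΦ (N := N) κ l (x - y) * φ y) := by
        refine Finset.sum_congr rfl fun l _ => ?_
        rw [← tsum_mul_comp_add_shift (fun z => wΦ (N := N) κ l z) φ x (unitVec l), ← (hf l).tsum_sub (hg l)]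
        exact tsum_congr fun y => by ring
    _ = ∑ l, ∑' y, (wΦ (N := N) κ l (x - y + unitVec l) - wΦ (N := N) κ l (x - y)) * φ y := by
        refine Finset.sum_congr rfl fun l _ => ?_
        rw [← (hs l).tsum_sub (hg l)]
        exact tsum_congr fun y => by ring
    _ = ∑' y, ∑ l, (wΦ (N := N) κ l (x - y + unitVec l) - wΦ (N := N) κ l (x - y)) * φ y :=
        (Summable.tsum_finsetSum fun l _ => ((hs l).sub (hg l)).congr fun y => by ring).symm
    _ = ∑' y, codiff₁ (fun l z => wΦ (N := N) κ l (x - z)) y * φ y := by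
        refine tsum_congr fun y => ?_
        rw [← Finset.sum_mul]
        congr 1
        simp only [codiff₁]
        refine Finset.sum_congr rfl fun l _ => ?_
        have e : x - (y - unitVec l) = x - y + unitVec l := by abel
        rw [e]
    _ = 0 := by
        simp [codiff₁_wΦ_right (N := N) κ x]

/-- [folklore] **`wΦ` KILLS PURE GAUGES OF LINEAR GROWTH (column form)**: `|φ y| ≤ A + B·|y|₁` ⟹ `Σ'_y Σ_l wΦ κ l (x − y)·(φ (y + e_l) − φ y) = 0`. -/
theorem tsum_wΦ_mul_grad_eq_zero_of_linGrowth (κ : Fin (d + 1)) (x : Site (d + 1)) {φ : Site (d + 1) → ℝ} {A B : ℝ}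
    (hφ : ∀ y, |φ y| ≤ A + B * l1 y) : ∑' y, ∑ l, wΦ (N := N) κ l (x - y) * (φ (y + unitVec l) - φ y) = 0 := by
  refine tsum_wΦ_mul_grad_eq_zero_of_summable κ x (fun l => ?_) (fun l => ?_) (fun l => ?_)
  · -- `φ (· + e_l)` has linear growth too
    have hφ' : ∀ y, |φ (y + unitVec l)| ≤ (A + |B| * l1 (unitVec l : Site (d + 1))) + |B| * l1 y := by
      intro y
      have h := hφ (y + unitVec l)
      have ht : l1 (y + unitVec l) ≤ l1 y + l1 (unitVec l : Site (d + 1)) := by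
        have h3 := l1_sub_triangle (y + unitVec l) y 0
        simp only [sub_zero, add_sub_cancel_left] at h3
        linarith [l1_sub_symm (y + unitVec l) y]
      have hBl : B * l1 (y + unitVec l) ≤ |B| * (l1 y + l1 (unitVec l : Site (d + 1))) :=
        (le_abs_self _).trans (by rw [abs_mul, abs_of_nonneg (l1_nonneg _)]; gcongr)
      linarith
    have h := summable_wΦ_shift_mul_of_linGrowth (N := N) hφ' κ l x 0
    simpa using h
  · have h := summable_wΦ_shift_mul_of_linGrowth (N := N) hφ κ l x 0
    simpa using h
  · exact summable_wΦ_shift_mul_of_linGrowth (N := N) hφ κ l x (unitVec l)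

/-- [folklore] **`wΦ` KILLS PURE GAUGES (row form, summable class)**. -/
theorem tsum_grad_mul_wΦ_eq_zero_of_summable (l : Fin (d + 1)) (y : Site (d + 1)) {φ : Site (d + 1) → ℝ}
    (hf : ∀ κ : Fin (d + 1), Summable fun x => wΦ (N := N) κ l (x - y) * φ (x + unitVec κ))
    (hg : ∀ κ : Fin (d + 1), Summable fun x => wΦ (N := N) κ l (x - y) * φ x)
    (hs : ∀ κ : Fin (d + 1), Summable fun x => wΦ (N := N) κ l (x - unitVec κ - y) * φ x) :
    ∑' x, ∑ κ, (φ (x + unitVec κ) - φ x) * wΦ (N := N) κ l (x - y) = 0 := by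
  have hfg : ∀ κ : Fin (d + 1), Summable fun x => (φ (x + unitVec κ) - φ x) * wΦ (N := N) κ l (x - y) := fun κ =>
    ((hf κ).sub (hg κ)).congr fun x => by ring
  have hshift : ∀ κ : Fin (d + 1), ∑' x, wΦ (N := N) κ l (x - y) * φ (x + unitVec κ)
      = ∑' x, wΦ (N := N) κ l (x - unitVec κ - y) * φ x := by
    intro κ
    rw [← (Equiv.subRight (unitVec κ)).tsum_eq (fun x => wΦ (N := N) κ l (x - y) * φ (x + unitVec κ))]
    refine tsum_congr fun x => ?_
    simp only [Equiv.subRight_apply, sub_add_cancel]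
  calc ∑' x, ∑ κ, (φ (x + unitVec κ) - φ x) * wΦ (N := N) κ l (x - y)
      = ∑ κ, ∑' x, (φ (x + unitVec κ) - φ x) * wΦ (N := N) κ l (x - y) :=
        Summable.tsum_finsetSum fun κ _ => hfg κ
    _ = ∑ κ, ((∑' x, wΦ (N := N) κ l (x - unitVec κ - y) * φ x) - ∑' x, wΦ (N := N) κ l (x - y) * φ x) := by
        refine Finset.sum_congr rfl fun κ _ => ?_
        rw [← hshift κ, ← (hf κ).tsum_sub (hg κ)]
        exact tsum_congr fun x => by ring
    _ = ∑ κ, ∑' x, (wΦ (N := N) κ l (x - unitVec κ - y) - wΦ (N := N) κ l (x - y)) * φ x := by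
        refine Finset.sum_congr rfl fun κ _ => ?_
        rw [← (hs κ).tsum_sub (hg κ)]
        exact tsum_congr fun x => by ring
    _ = ∑' x, ∑ κ, (wΦ (N := N) κ l (x - unitVec κ - y) - wΦ (N := N) κ l (x - y)) * φ x :=
        (Summable.tsum_finsetSum fun κ _ => ((hs κ).sub (hg κ)).congr fun x => by ring).symm
    _ = ∑' x, codiff₁ (fun κ z => wΦ (N := N) κ l (z - y)) x * φ x := by
        refine tsum_congr fun x => ?_
        rw [← Finset.sum_mul]
        rfl
    _ = 0 := by
        simp [codiff₁_wΦ_shift (N := N) l y]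

/-- [folklore] **`wΦ` KILLS PURE GAUGES OF LINEAR GROWTH (row form)**. -/
theorem tsum_grad_mul_wΦ_eq_zero_of_linGrowth (l : Fin (d + 1)) (y : Site (d + 1)) {φ : Site (d + 1) → ℝ} {A B : ℝ}
    (hφ : ∀ x, |φ x| ≤ A + B * l1 x) : ∑' x, ∑ κ, (φ (x + unitVec κ) - φ x) * wΦ (N := N) κ l (x - y) = 0 := by
  refine tsum_grad_mul_wΦ_eq_zero_of_summable l y (fun κ => ?_) (fun κ => ?_) (fun κ => ?_)
  · have hφ' : ∀ x, |φ (x + unitVec κ)| ≤ (A + |B| * l1 (unitVec κ : Site (d + 1))) + |B| * l1 x := by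
      intro x
      have h := hφ (x + unitVec κ)
      have ht : l1 (x + unitVec κ) ≤ l1 x + l1 (unitVec κ : Site (d + 1)) := by
        have h3 := l1_sub_triangle (x + unitVec κ) x 0
        simp only [sub_zero, add_sub_cancel_left] at h3
        linarith [l1_sub_symm (x + unitVec κ) x]
      have hBl : B * l1 (x + unitVec κ) ≤ |B| * (l1 x + l1 (unitVec κ : Site (d + 1))) :=
        (le_abs_self _).trans (by rw [abs_mul, abs_of_nonneg (l1_nonneg _)]; gcongr)
      linarith
    have h := summable_wΦ_row_mul_of_linGrowth (N := N) hφ' κ l y 0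
    simpa using h
  · have h := summable_wΦ_row_mul_of_linGrowth (N := N) hφ κ l y 0
    simpa using h
  · exact summable_wΦ_row_mul_of_linGrowth (N := N) hφ κ l y (unitVec κ)

end WΦ

/-! ## §3 The value Hessian `E2 d Lc j`: linear-growth gauges, constants, the exit-face profile -/

section ValueHessian

variable {Lc : ℕ} [NeZero Lc]

/-- [folklore] **THE VALUE HESSIAN KILLS PURE GAUGES OF LINEAR GROWTH (column form)**, every step `j`:
`Σ'_y Σ_l E2 d Lc j (x,y)_{inl κ, inl l}·(φ (y + e_l) − φ y) = 0` for `|φ y| ≤ A + B·|y|₁`. -/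
theorem tsum_E2_mul_grad_eq_zero_of_linGrowth (j : ℕ) (κ : Fin (d + 1)) (x : Site (d + 1)) {φ : Site (d + 1) → ℝ} {A B : ℝ}
    (hφ : ∀ y, |φ y| ≤ A + B * l1 y) : ∑' y, ∑ l, E2 d Lc j x y (Sum.inl κ) (Sum.inl l) * (φ (y + unitVec l) - φ y) = 0 := by
  simp only [E2_inl_inl_eq_wΦ]
  exact tsum_wΦ_mul_grad_eq_zero_of_linGrowth (N := Lc ^ j) κ x hφ

/-- [folklore] **… row form**: `Σ'_x Σ_κ (φ (x + e_κ) − φ x)·E2 d Lc j (x,y)_{inl κ, inl l} = 0`. -/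
theorem tsum_grad_mul_E2_eq_zero_of_linGrowth (j : ℕ) (l : Fin (d + 1)) (y : Site (d + 1)) {φ : Site (d + 1) → ℝ} {A B : ℝ}
    (hφ : ∀ x, |φ x| ≤ A + B * l1 x) : ∑' x, ∑ κ, (φ (x + unitVec κ) - φ x) * E2 d Lc j x y (Sum.inl κ) (Sum.inl l) = 0 := by
  simp only [E2_inl_inl_eq_wΦ]
  exact tsum_grad_mul_wΦ_eq_zero_of_linGrowth (N := Lc ^ j) l y hφ

/-- [folklore] The linear potential of a constant 1-form: `φ y = Σ_α y_α·c α` has `φ (y + e_l) − φ y = c l` and linear growth. -/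
theorem linPot_grad (c : Fin (d + 1) → ℝ) (y : Site (d + 1)) (l : Fin (d + 1)) :
    (∑ α, ((y + unitVec l) α : ℝ) * c α) - ∑ α, (y α : ℝ) * c α = c l := by
  rw [← Finset.sum_sub_distrib]
  have e : ∀ α : Fin (d + 1), ((y + unitVec l) α : ℝ) * c α - (y α : ℝ) * c α = if α = l then c l else 0 := by
    intro α
    simp only [Pi.add_apply, AffineAveraging.unitVec, Pi.single_apply, Int.cast_add]
    split_ifs with h
    · subst h; push_cast; ring
    · push_cast; ring
  rw [Finset.sum_congr rfl fun α _ => e α, Finset.sum_ite_eq' Finset.univ l, if_pos (Finset.mem_univ l)]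

/-- [folklore] Linear growth of the linear potential: `|Σ_α y_α·c α| ≤ (Σ_α |c α|)·|y|₁`. -/
theorem abs_linPot_le (c : Fin (d + 1) → ℝ) (y : Site (d + 1)) : |∑ α, (y α : ℝ) * c α| ≤ 0 + (∑ α, |c α|) * l1 y := by
  rw [zero_add, Finset.sum_mul]
  refine (Finset.abs_sum_le_sum_abs _ _).trans (Finset.sum_le_sum fun α _ => ?_)
  rw [abs_mul, mul_comm]
  exact mul_le_mul_of_nonneg_left (abs_coord_le_l1 y α) (abs_nonneg _)

/-- [folklore] **THE VALUE HESSIAN KILLS CONSTANT 1-FORMS (column form)** — the (S2c)-type reading «`E2 ĉ = 0`» at every step: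
`Σ'_y Σ_l E2 d Lc j (x,y)_{inl κ, inl l}·c l = 0`. -/
theorem tsum_E2_mul_const_eq_zero (j : ℕ) (κ : Fin (d + 1)) (x : Site (d + 1)) (c : Fin (d + 1) → ℝ) :
    ∑' y, ∑ l, E2 d Lc j x y (Sum.inl κ) (Sum.inl l) * c l = 0 := by
  have h := tsum_E2_mul_grad_eq_zero_of_linGrowth (Lc := Lc) j κ x (φ := fun y => ∑ α, (y α : ℝ) * c α) (abs_linPot_le c)
  simp only [linPot_grad] at h
  exact h

/-- [folklore] **… row form**: `Σ'_x Σ_κ c κ·E2 d Lc j (x,y)_{inl κ, inl l} = 0`. -/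
theorem tsum_const_mul_E2_eq_zero (j : ℕ) (l : Fin (d + 1)) (y : Site (d + 1)) (c : Fin (d + 1) → ℝ) :
    ∑' x, ∑ κ, c κ * E2 d Lc j x y (Sum.inl κ) (Sum.inl l) = 0 := by
  have h := tsum_grad_mul_E2_eq_zero_of_linGrowth (Lc := Lc) j l y (φ := fun x => ∑ α, (x α : ℝ) * c α) (abs_linPot_le c)
  simp only [linPot_grad] at h
  exact h

/-- [folklore] The STAIRCASE potential of the exit-face profile of the `N`-blocks in direction `β`: `φ y = g·⌊y_β ∕ N⌋` has
`φ (y + e_l) − φ y = [l = β]·[y_β % N = N − 1]·g` (`PiBmConstants.int_succ_ediv`). -/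
theorem staircase_grad {N : ℕ} (hN : 1 ≤ N) (g : ℝ) (β : Fin (d + 1)) (y : Site (d + 1)) (l : Fin (d + 1)) :
    g * (((y + unitVec l) β / (N : ℤ) : ℤ) : ℝ) - g * ((y β / (N : ℤ) : ℤ) : ℝ) =
      if l = β then (if y β % (N : ℤ) = (N : ℤ) - 1 then g else 0) else 0 := by
  have hN0 : (0 : ℤ) < N := by exact_mod_cast hN
  by_cases hl : l = β
  · subst hl
    simp only [Pi.add_apply, AffineAveraging.unitVec, Pi.single_eq_same, if_true]
    rw [int_succ_ediv hN0]
    split_ifs <;> push_cast <;> ring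
  · have e : (y + unitVec l) β = y β := by
      simp only [Pi.add_apply, AffineAveraging.unitVec, Pi.single_apply, if_neg (Ne.symm hl), add_zero]
    rw [e, sub_self, if_neg hl]

/-- [folklore] Linear growth of the staircase potential: `|g·⌊y_β∕N⌋| ≤ 0 + |g|·|y|₁` (`|⌊a∕N⌋| ≤ |a|`). -/
theorem abs_staircase_le (N : ℕ) (g : ℝ) (β : Fin (d + 1)) (y : Site (d + 1)) :
    |g * ((y β / (N : ℤ) : ℤ) : ℝ)| ≤ 0 + |g| * l1 y := by
  rw [abs_mul, zero_add]
  have hq : |((y β / (N : ℤ) : ℤ) : ℝ)| ≤ l1 y := by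
    have h1 : |y β / (N : ℤ)| ≤ |y β| := Int.abs_ediv_le_abs _ _
    have h2 : |((y β / (N : ℤ) : ℤ) : ℝ)| ≤ |(y β : ℝ)| := by
      rw [← Int.cast_abs, ← Int.cast_abs]
      exact_mod_cast h1
    exact h2.trans (abs_coord_le_l1 y β)
  exact mul_le_mul_of_nonneg_left hq (abs_nonneg g)

/-- [folklore] **THE VALUE HESSIAN KILLS THE EXIT-FACE PROFILE (column form)**: for every `N ≥ 1`, direction `β`, weight `g`,
`Σ'_y Σ_l E2 d Lc j (x,y)_{inl κ, inl l}·([l = β]·[y_β % N = N−1]·g) = 0`. -/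
theorem tsum_E2_mul_exitFace_eq_zero (j : ℕ) {N : ℕ} (hN : 1 ≤ N) (κ β : Fin (d + 1)) (x : Site (d + 1)) (g : ℝ) :
    ∑' y, ∑ l, E2 d Lc j x y (Sum.inl κ) (Sum.inl l) * (if l = β then (if y β % (N : ℤ) = (N : ℤ) - 1 then g else 0) else 0) = 0 := by
  have h := tsum_E2_mul_grad_eq_zero_of_linGrowth (Lc := Lc) j κ x (φ := fun y => g * ((y β / (N : ℤ) : ℤ) : ℝ)) (abs_staircase_le N g β)
  simp only [staircase_grad hN] at h
  exact h

/-- [folklore] … single-direction form: `Σ'_y E2 d Lc j (x,y)_{inl κ, inl β}·([y_β % N = N−1]·g) = 0`. -/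
theorem tsum_E2_mul_exitFace_eq_zero' (j : ℕ) {N : ℕ} (hN : 1 ≤ N) (κ β : Fin (d + 1)) (x : Site (d + 1)) (g : ℝ) :
    ∑' y, E2 d Lc j x y (Sum.inl κ) (Sum.inl β) * (if y β % (N : ℤ) = (N : ℤ) - 1 then g else 0) = 0 := by
  have h := tsum_E2_mul_exitFace_eq_zero (Lc := Lc) j hN κ β x g
  simp only [mul_ite, mul_zero, Finset.sum_ite_eq', Finset.mem_univ, if_true] at h
  simpa only [mul_ite, mul_zero] using h

/-- [folklore] **THE VALUE HESSIAN KILLS THE EXIT-FACE PROFILE (row form)**. -/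
theorem tsum_exitFace_mul_E2_eq_zero (j : ℕ) {N : ℕ} (hN : 1 ≤ N) (l β : Fin (d + 1)) (y : Site (d + 1)) (g : ℝ) :
    ∑' x, ∑ κ, (if κ = β then (if x β % (N : ℤ) = (N : ℤ) - 1 then g else 0) else 0) * E2 d Lc j x y (Sum.inl κ) (Sum.inl l) = 0 := by
  have h := tsum_grad_mul_E2_eq_zero_of_linGrowth (Lc := Lc) j l y (φ := fun x => g * ((x β / (N : ℤ) : ℤ) : ℝ)) (abs_staircase_le N g β)
  simp only [staircase_grad hN] at h
  exact h

/-- [folklore] … single-direction form: `Σ'_x ([x_β % N = N−1]·g)·E2 d Lc j (x,y)_{inl β, inl l} = 0`. -/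
theorem tsum_exitFace_mul_E2_eq_zero' (j : ℕ) {N : ℕ} (hN : 1 ≤ N) (l β : Fin (d + 1)) (y : Site (d + 1)) (g : ℝ) :
    ∑' x, (if x β % (N : ℤ) = (N : ℤ) - 1 then g else 0) * E2 d Lc j x y (Sum.inl β) (Sum.inl l) = 0 := by
  have h := tsum_exitFace_mul_E2_eq_zero (Lc := Lc) j hN l β y g
  simp only [ite_mul, zero_mul, Finset.sum_ite_eq', Finset.mem_univ, if_true] at h
  simpa only [ite_mul, zero_mul] using h

end ValueHessian


/-! ## §4 Block contour sums of «periodic function of `y_ν` × exit-face profile on `β`-bonds» vanish across directions -/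

section Contour

variable {Lc : ℕ} [NeZero Lc]

omit [NeZero Lc] in
/-- [folklore] **THE TENT DATUM OF THE (C) WORDS HAS ZERO BLOCK CONTOUR SUMS ACROSS DIRECTIONS**: for `ν ≠ β`, an `Lc`-periodic `ψ : ℤ → ℝ` with
`Σ_{t<Lc} ψ t = 0` (the sawtooth), and any direction `κ`,
`contourSum Lc (l,w ↦ [l = β]·ψ(w_ν)·[w_β % Lc = Lc − 1]) κ y = 0` — along a `β`-contour `w_ν` is constant, and the base points of one block see every residue of
`w_ν` equally often (`PeriodicKKTExchangePairing.sum_box_mul_coord`). -/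
theorem contourSum_periodic_mul_exitFace_eq_zero {ψ : ℤ → ℝ} (hper : ∀ (t k : ℤ), ψ (t + (Lc : ℤ) * k) = ψ t)
    (hsum : ∑ t ∈ Finset.range Lc, ψ t = 0) {ν β : Fin (d + 1)} (hνβ : ν ≠ β) (κ : Fin (d + 1)) (y : Site (d + 1)) :
    contourSum Lc (fun l w => if l = β then ψ (w ν) * (if w β % (Lc : ℤ) = (Lc : ℤ) - 1 then (1 : ℝ) else 0) else 0) κ y = 0 := by
  unfold AffineAveraging.contourSum
  by_cases hκ : κ = β
  · subst hκ
    simp only [if_true]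
    have eν : ∀ (b : Fin (d + 1) → ℕ) (s : ℕ), ((Lc : ℤ) • y + toSite b + (s : ℤ) • unitVec κ) ν = (Lc : ℤ) * y ν + toSite b ν := by
      intro b s
      simp only [Pi.add_apply, Pi.smul_apply, smul_eq_mul, AffineAveraging.unitVec, Pi.single_apply, if_neg hνβ, mul_zero, add_zero]
    have eβ : ∀ (b : Fin (d + 1) → ℕ) (s : ℕ), ((Lc : ℤ) • y + toSite b + (s : ℤ) • unitVec κ) κ = (Lc : ℤ) * y κ + toSite b κ + s := by
      intro b s
      simp only [Pi.add_apply, Pi.smul_apply, smul_eq_mul, AffineAveraging.unitVec, Pi.single_eq_same, mul_one]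
    simp_rw [eν, eβ]
    have e2 : ∀ b : Fin (d + 1) → ℕ, (∑ s ∈ Finset.range Lc, ψ ((Lc : ℤ) * y ν + toSite b ν) *
        (if ((Lc : ℤ) * y κ + toSite b κ + (s : ℤ)) % (Lc : ℤ) = (Lc : ℤ) - 1 then (1 : ℝ) else 0)) =
        (fun t : ℤ => ψ ((Lc : ℤ) * y ν + t)) (toSite b ν) *
          (fun t : ℤ => ∑ s ∈ Finset.range Lc, (if ((Lc : ℤ) * y κ + t + (s : ℤ)) % (Lc : ℤ) = (Lc : ℤ) - 1 then (1 : ℝ) else 0)) (toSite b κ) := by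
      intro b
      rw [Finset.mul_sum]
    rw [Finset.sum_congr rfl fun b _ => e2 b,
      sum_box_mul_coord (N := Lc) hνβ (fun t : ℤ => ψ ((Lc : ℤ) * y ν + t))
        (fun t : ℤ => ∑ s ∈ Finset.range Lc, (if ((Lc : ℤ) * y κ + t + (s : ℤ)) % (Lc : ℤ) = (Lc : ℤ) - 1 then (1 : ℝ) else 0))]
    have hf : ∑ t ∈ Finset.range Lc, (fun t : ℤ => ψ ((Lc : ℤ) * y ν + t)) (t : ℤ) = 0 := by
      have e : ∀ t : ℕ, (fun t : ℤ => ψ ((Lc : ℤ) * y ν + t)) (t : ℤ) = ψ t := by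
        intro t
        show ψ ((Lc : ℤ) * y ν + (t : ℤ)) = ψ t
        rw [show (Lc : ℤ) * y ν + (t : ℤ) = (t : ℤ) + (Lc : ℤ) * y ν by ring, hper]
      simp_rw [e]
      exact hsum
    rw [hf, mul_zero, zero_mul]
  · simp [hκ]

end Contour

end Summit.QuantumFields.BalabanUV.Beta.GAN24.ValueHessianLinearGauge

end
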